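import Mathlib
import HarnessLib

/-!
# Tukey's PSEUDO-VALUES: the engine's bias-corrected jackknife pair `(bias_corr, err)` IS the replica mean and the replica-`t` standard error of the pseudo-value vector — exactly, for every statistic and every sample

HONEST FRAMING: exact (Metropolis-corrected) sampling algorithms for lattice gauge theory;
figures of merit are autocorrelation/cost numbers at stated couplings and volumes; no
continuum-physics claim.

Venture `LatticeQCDFlow` (cell pub-lqcd), topic `Exactness`; FANOUT row 13 (`eng-snf`, GEN-25).
NEW WORK of the cell (elementary algebra), Mathlib only; not a published result; no definition;
nothing cited as a fact (Quenouille 1949 / Tukey 1958 pseudo-values NAMED ONLY).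

WHY (row 13).  `latflow-snf`'s `estimators.jackknife(stat, n, blocks)` returns, for ANY scalar
statistic, the triple `(full, bias_corr, err)` with `full = stat(all)`, replicates
`rep_r = stat(all but block r)` (`R = len(blocks) ≥ 2`), `m = (1/R) Σ_r rep_r`,
`err = √(((R−1)/R) Σ_r (rep_r − m)²)` and `bias_corr = R·full − (R−1)·m`.  GEN-24
(`…ReplicaJackknifeIdentity`) identified `(full, err)` with the replica-`t` pair when the statistic
is a MEAN; GEN-25 (`…ReplicaJackknifeDeltaMethod`, `…BiasSign`) treated nonlinear statistics
asymptotically and the sign of the correction.  This file records the exact finite-sample structure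
behind the bias-corrected pair for an ARBITRARY statistic: with Tukey's pseudo-values
`ps_r = R·full − (R−1)·rep_r` one has `bias_corr = p̄s` (their mean) and
`err² = Σ_r (ps_r − p̄s)²/(R(R−1))` (their replica-`t` variance) — so the printed bias-corrected bar
`bias_corr ± q·err` IS the replica-`t` / "independent runs" bar of GEN-23/24 applied to the vector
of pseudo-values, and `{|bias_corr − θ| ≤ q·err}` is literally the replica-`t` acceptance event
`{|t((ps_r − θ)_r)| ≤ q}`: every statement of the replica-`t` dictionary (limiting coverage
`L_R(q)` whenever the centred, `√n`-scaled pseudo-value vector converges to a non-degenerate product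
Gaussian — GEN-23 K3; its value — GEN-24 S/B/T/F7) transfers verbatim to the bias-corrected
jackknife of any statistic.  (The UNcorrected centre `full` differs from `p̄s` by `(R−1)(full − m)`,
which GEN-25 showed to be `o_P(n^{−1/2})` for smooth statistics of pooled means and of definite
sign for convex ones.)

* `pseudoValue_sub_mean` (§1) — `ps_r − p̄s = −(R−1)(rep_r − m)`; `mean_pseudoValue` —
  `p̄s = bias_corr`.
* **`jackknife_variance_eq_pseudoValue_tVariance`** (§1) —
  `((R−1)/R) Σ_r (rep_r − m)² = Σ_r (ps_r − p̄s)²/(R(R−1))`.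
* **`jackknife_biasCorrected_studentised_eq_tStat_pseudoValue`** (§2) — the studentised deviation
  `(bias_corr − θ)/err` equals the replica-`t` statistic of `(ps_r − θ)_r` (GEN-23 K's form);
  **`setOf_abs_biasCorrected_sub_le_mul_err_eq`** — same acceptance event, for random replicates.

NOT CLAIMED: any limit theorem for pseudo-values (see GEN-25 `…ReplicaJackknifeDeltaMethod`);
anything numerical.
-/

namespace Summit.Ventures.LatticeQCDFlow.Exactness.GeneralNCMC

open Finset

section PseudoValues

variable {ι : Type*} [Fintype ι]

/-! ## §1 Pseudo-values: mean and spread -/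

/-- **The mean of the pseudo-values is the bias-corrected estimate**:
`(1/R) Σ_r (R·F − (R−1)·G_r) = R·F − (R−1)·Ḡ`. -/
theorem mean_pseudoValue [Nonempty ι] (F : ℝ) (G : ι → ℝ) :
    (∑ r, ((Fintype.card ι : ℝ) * F - ((Fintype.card ι : ℝ) - 1) * G r)) / Fintype.card ι
      = (Fintype.card ι : ℝ) * F - ((Fintype.card ι : ℝ) - 1) * ((∑ r, G r) / Fintype.card ι) := by
  have hR0 : (Fintype.card ι : ℝ) ≠ 0 := Nat.cast_ne_zero.2 Fintype.card_ne_zero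
  rw [sum_sub_distrib, sum_const, card_univ, nsmul_eq_mul, ← mul_sum]
  field_simp

/-- **A pseudo-value minus the pseudo-value mean is `−(R−1)` times the replicate's deviation**:
`ps_r − p̄s = −(R−1)(G_r − Ḡ)`. -/
theorem pseudoValue_sub_mean [Nonempty ι] (F : ℝ) (G : ι → ℝ) (r : ι) :
    ((Fintype.card ι : ℝ) * F - ((Fintype.card ι : ℝ) - 1) * G r)
        - (∑ t, ((Fintype.card ι : ℝ) * F - ((Fintype.card ι : ℝ) - 1) * G t)) / Fintype.card ι
      = -(((Fintype.card ι : ℝ) - 1) * (G r - (∑ t, G t) / Fintype.card ι)) := by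
  rw [mean_pseudoValue]
  ring

/-- **JACKKNIFE VARIANCE = REPLICA-`t` VARIANCE OF THE PSEUDO-VALUES** (exactly, any statistic,
`R ≥ 2`): `((R−1)/R) Σ_r (G_r − Ḡ)² = Σ_r (ps_r − p̄s)² / (R(R−1))`. -/
theorem jackknife_variance_eq_pseudoValue_tVariance (hR : 2 ≤ Fintype.card ι) (F : ℝ)
    (G : ι → ℝ) :
    ((Fintype.card ι : ℝ) - 1) / Fintype.card ι * ∑ r, (G r - (∑ t, G t) / Fintype.card ι) ^ 2
      = (∑ r, (((Fintype.card ι : ℝ) * F - ((Fintype.card ι : ℝ) - 1) * G r)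
          - (∑ t, ((Fintype.card ι : ℝ) * F - ((Fintype.card ι : ℝ) - 1) * G t))
              / Fintype.card ι) ^ 2)
        / ((Fintype.card ι : ℝ) * (Fintype.card ι - 1)) := by
  haveI : Nonempty ι := Fintype.card_pos_iff.1 (by omega)
  have hR0 : (Fintype.card ι : ℝ) ≠ 0 := Nat.cast_ne_zero.2 Fintype.card_ne_zero
  have hR1 : (Fintype.card ι : ℝ) - 1 ≠ 0 := by
    have : (2 : ℝ) ≤ Fintype.card ι := by exact_mod_cast hR
    linarith
  simp_rw [pseudoValue_sub_mean F G, neg_sq, mul_pow]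
  rw [← mul_sum]
  field_simp

/-! ## §2 The bias-corrected bar is the replica-`t` bar of the pseudo-values -/

/-- Centring pseudo-values at `θ` commutes with their mean. -/
theorem mean_pseudoValue_sub [Nonempty ι] (F : ℝ) (G : ι → ℝ) (θ : ℝ) :
    (∑ r, (((Fintype.card ι : ℝ) * F - ((Fintype.card ι : ℝ) - 1) * G r) - θ)) / Fintype.card ι
      = (Fintype.card ι : ℝ) * F - ((Fintype.card ι : ℝ) - 1) * ((∑ r, G r) / Fintype.card ι)
        - θ := by
  have hR0 : (Fintype.card ι : ℝ) ≠ 0 := Nat.cast_ne_zero.2 Fintype.card_ne_zero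
  rw [sum_sub_distrib, sum_const, card_univ, nsmul_eq_mul, sub_div, mul_div_cancel_left₀ θ hR0,
    mean_pseudoValue]

/-- **THE BIAS-CORRECTED JACKKNIFE-STUDENTISED DEVIATION IS THE REPLICA-`t` STATISTIC OF THE
CENTRED PSEUDO-VALUES** (GEN-23 K's form `z̄ / √(Σ_r (z_r − z̄)²/(R(R−1)))` with
`z_r = ps_r − θ`), for every statistic, every centre `θ` and every sample (`R ≥ 2`). -/
theorem jackknife_biasCorrected_studentised_eq_tStat_pseudoValue (hR : 2 ≤ Fintype.card ι) (F : ℝ)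
    (G : ι → ℝ) (θ : ℝ) :
    ((Fintype.card ι : ℝ) * F - ((Fintype.card ι : ℝ) - 1) * ((∑ r, G r) / Fintype.card ι) - θ)
        / Real.sqrt (((Fintype.card ι : ℝ) - 1) / Fintype.card ι
          * ∑ r, (G r - (∑ t, G t) / Fintype.card ι) ^ 2)
      = (∑ r, (((Fintype.card ι : ℝ) * F - ((Fintype.card ι : ℝ) - 1) * G r) - θ))
          / Fintype.card ι
        / Real.sqrt ((∑ r, ((((Fintype.card ι : ℝ) * F - ((Fintype.card ι : ℝ) - 1) * G r) - θ)
            - (∑ r', (((Fintype.card ι : ℝ) * F - ((Fintype.card ι : ℝ) - 1) * G r') - θ))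
                / Fintype.card ι) ^ 2)
            / ((Fintype.card ι : ℝ) * (Fintype.card ι - 1))) := by
  haveI : Nonempty ι := Fintype.card_pos_iff.1 (by omega)
  have hsum : (∑ r, ((((Fintype.card ι : ℝ) * F - ((Fintype.card ι : ℝ) - 1) * G r) - θ)
        - ((Fintype.card ι : ℝ) * F - ((Fintype.card ι : ℝ) - 1) * ((∑ r', G r') / Fintype.card ι)
            - θ)) ^ 2)
      = ∑ r, (((Fintype.card ι : ℝ) * F - ((Fintype.card ι : ℝ) - 1) * G r)
          - (∑ t, ((Fintype.card ι : ℝ) * F - ((Fintype.card ι : ℝ) - 1) * G t))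
              / Fintype.card ι) ^ 2 :=
    sum_congr rfl fun r _ => by rw [mean_pseudoValue]; ring
  rw [mean_pseudoValue_sub, jackknife_variance_eq_pseudoValue_tVariance hR F G, hsum]

/-- **Same acceptance event**: for random replicates `G : Ω → ι → ℝ` and full values `F : Ω → ℝ`,
the bias-corrected jackknife bar `{|bias_corr − θ| ≤ q·err}` (as the studentised ratio) is the
replica-`t` acceptance event of the centred pseudo-values — every replica-`t` coverage statement
(GEN-23 K3 `tendsto_measure_abs_tStat_le_of_pi_gaussianReal` and its dictionary) applies to it
verbatim. -/
theorem setOf_abs_biasCorrected_studentised_le_eq {Ω : Type*} (hR : 2 ≤ Fintype.card ι)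
    (F : Ω → ℝ) (G : Ω → ι → ℝ) (θ q : ℝ) :
    {ω : Ω | |((Fintype.card ι : ℝ) * F ω
          - ((Fintype.card ι : ℝ) - 1) * ((∑ r, G ω r) / Fintype.card ι) - θ)
        / Real.sqrt (((Fintype.card ι : ℝ) - 1) / Fintype.card ι
          * ∑ r, (G ω r - (∑ t, G ω t) / Fintype.card ι) ^ 2)| ≤ q}
      = {ω : Ω | |(∑ r, (((Fintype.card ι : ℝ) * F ω - ((Fintype.card ι : ℝ) - 1) * G ω r) - θ))
            / Fintype.card ι
          / Real.sqrt ((∑ r,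
              ((((Fintype.card ι : ℝ) * F ω - ((Fintype.card ι : ℝ) - 1) * G ω r) - θ)
              - (∑ r', (((Fintype.card ι : ℝ) * F ω - ((Fintype.card ι : ℝ) - 1) * G ω r') - θ))
                  / Fintype.card ι) ^ 2)
              / ((Fintype.card ι : ℝ) * (Fintype.card ι - 1)))| ≤ q} := by
  ext ω
  simp only [Set.mem_setOf_eq, jackknife_biasCorrected_studentised_eq_tStat_pseudoValue hR]

end PseudoValues

end Summit.Ventures.LatticeQCDFlow.Exactness.GeneralNCMC
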